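import Summits.ResolutionOfSingularities.ResolutionOfSingularities.Theorems.WeightedInvariantIota3FlagDeltaBridge
import Mathlib.RingTheory.PowerSeries.Trunc
import HarnessLib

/-!
# R10b FLAG–δ BRIDGE (PART 3): THE `g₁`-CLAUSE FOR TRANSLATE FLAGS — `mem_monomialIdeal_of_translate_reaches` (§3e, modulo the automorphism
# `X ↦ X + C φ`) and, WITHOUT automorphism or completeness, `mem_monomialIdeal_of_translate_flag_reaches` / `translate_first_member_mem` (§3f)

**Provenance / honest framing** — as in PART 1 (`…Iota3FlagDeltaBridgeDefs`): VERBATIM PORT of res-L1-w43-idea-2's Sketch-R10b, here **rev 4**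
(`L/res-L1-w43-idea-2/Sketch-R10b.lean` 034b05676038c1ed, 823 l.; rev 4 = rev 3 + §3e/§3f, frozen for the porter), namespace `…LocalEngine.Iota3`
(from `…Iota3.JCanCensus`), dealt by res-L1-w43-plan-1 (STATUS 2026-08-27T21:18:33Z / 21:24:05Z / 21:24:31Z; door `stmt-ResolutionOfSingularities-19897`,
BOOKED as candidate input for the FIRST-MEMBER clause of SPEC (Δ12) rev 4 l.223 `TwoFlagDominanceAtLevelAt`; consumer res-D-brk-1 decides use), ported by
res-L1-type-o4, `--supports stmt-ResolutionOfSingularities-19897 --as helper`. [OURS · L1 w43 · idea-2 R10b] OURS elementary commutative algebra over Mathlib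
(`PowerSeries.trunc`, `Polynomial.taylor`), the tree's `flagContactFiltration` and the LANDED Cossart–Piltant calculus (Hironaka (4.8) PROVED there); two OURS
bookkeeping defs (`polyFrame`, `psFrame`: the frames `(C u₀, C u₁, X − C φ)` of `S₀[X]` / `S₀⟦X⟧`); NOT a statement of H. Hironaka's 2017 manuscript (nothing
of it asserted or used); no Literature fact introduced; AI-written/ported, weaker than expert review; no progress claim.

## Contents (Sketch-R10b rev 4 §3e, §3f verbatim)
* §3e `mem_monomialIdeal_of_translate_reaches`: if the flag `(X; C u₁)` reaches the translate `h(X + φ)` at level `r₁ν` (`h` monic, Hironaka-minimal,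
  `S₀` Noetherian local with `𝔪 = (u₀,u₁)` and (H)), then `φ ∈ I_α(u; 1)` — two lines over PART 2 (§3c + §1).
* §3f `trunc_mem_of_mem_map_coe` / `mem_of_coe_mem_map_coe` (contraction along `S₀[X] → S₀⟦X⟧`), `polyFrame` / `psFrame` (+ `coe_comp_polyFrame`,
  `taylor_comp_polyFrame`, `maximalIdeal_powerSeries_eq_span_psFrame`, `X_pow_mem_monomialIdeal_polyFrame`), and
  **`mem_monomialIdeal_of_translate_flag_reaches`** / **`translate_first_member_mem`**: IF THE TRANSLATE FLAG `(X − C φ; C u₁)` REACHES `h` in `S₀⟦X⟧`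
  at level `r₁ν` then `φ ∈ I_α(u;1)`, equivalently `X − C φ ∈ F_(X; C u₁)(r₁)` — every admissible `(q; r₁, r₂)`, separable or not.
VERBATIM except three lint fixes the gate requires (two unused `simp` arguments dropped, one `omit [IsLocalRing S₀] in`) and seven bookkeeping docstrings added.
-/

noncomputable section

open Polynomial IsLocalRing
open Literature.AlgebraicGeometry.Resolution.CossartPiltant
open Summit.ResolutionOfSingularities.ResolutionOfSingularities.Theorems

set_option linter.dupNamespace false

namespace Summit.ResolutionOfSingularities.ResolutionOfSingularities.Cruxes.HypersurfaceCentreConstruction.LocalEngine.Iota3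

/-! ### §3e The `g₁`-clause for translates, modulo the automorphism `X ↦ X + C φ` -/

section BridgeTranslate

variable {S₀ : Type*} [CommRing S₀] [IsLocalRing S₀]

/-- **§3e THE `g₁`-CLAUSE FOR TRANSLATES, modulo the automorphism `X ↦ X + C φ` (R10b · OURS · PROVED)**.  `S₀` Noetherian local with
`𝔪_{S₀} = (u₀, u₁)` radical-generated and (H); `h ∈ S₀[X]` monic of degree `ν ≥ 1` with NO solvable vertex (`IsMinimal u h` — the hub
first member is `X`); `φ ∈ S₀`.  IF the flag `(X; C u₁)` reaches the translate `h(X + φ)` at level `r₁ ν` — which, transported by the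
`S₀`-automorphism `X ↦ X + C φ` of `S₀⟦X⟧` (available for `S₀` complete, `φ ∈ 𝔪_{S₀}`), says: THE TRANSLATE FLAG `(X − C φ; C u₁)` REACHES
`h` — THEN `φ ∈ I_α(u; 1)`, `α = (q/r₁, r₂/r₁)`, i.e. `q·a + r₂·b ≥ r₁` on the minimal exponents of `φ`: the competing first member `X − C φ`
lies in `F_{(X; C u₁)}(r₁)` — the `g₁`-clause of `TwoFlagDominanceAtLevelAt` (SPEC (Δ12) rev 4 l.223) for translates, at EVERY ratio,
separable or not.  Two lines: §3c + §1. [OURS · R10b §3e · PROVED modulo the named automorphism, which the user supplies in the model] -/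
theorem mem_monomialIdeal_of_translate_reaches [IsNoetherianRing S₀] (u : Fin 2 → S₀)
    (hm : maximalIdeal S₀ = Ideal.span (Set.range u))
    (H : ∀ (i : Fin 2) (T : Finset (Fin 2)), i ∉ T →
      ∀ y, u i * y ∈ Ideal.span (u '' ↑T) → y ∈ Ideal.span (u '' ↑T))
    (hrad : (Ideal.span (Set.range u)).IsRadical)
    {h : S₀[X]} (hh : h.Monic) (hm1 : 1 ≤ h.natDegree) (hmin : IsMinimal u h)
    {q r₁ r₂ : ℕ} (hadm : AdmissibleTriple q r₁ r₂) (φ : S₀)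
    (hreach : ((taylor φ h : S₀[X]) : PowerSeries S₀) ∈
      flagContactFiltration (PowerSeries.X : PowerSeries S₀) (PowerSeries.C (u 1)) q r₁ r₂ (r₁ * h.natDegree)) :
    φ ∈ monomialIdeal u (bridgeWeights q r₁ r₂) 1 := by
  have hu : ∀ i, u i ∈ maximalIdeal S₀ := fun i => by rw [hm]; exact Ideal.subset_span ⟨i, rfl⟩
  obtain ⟨hq, hqr₂, hr₂r₁⟩ := hadm
  have hα : ∀ j, 0 < bridgeWeights q r₁ r₂ j := by
    have hr₁ : (0 : ℝ) < r₁ := by exact_mod_cast (lt_of_lt_of_le hq (hqr₂.trans hr₂r₁))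
    intro j
    fin_cases j
    · simp only [bridgeWeights_zero, Fin.zero_eta]
      exact div_pos (by exact_mod_cast hq) hr₁
    · simp only [bridgeWeights_one, Fin.mk_one]
      exact div_pos (by exact_mod_cast (lt_of_lt_of_le hq hqr₂)) hr₁
  have h1 : DeltaGE u (bridgeWeights q r₁ r₂) (taylor φ h) 1 := by
    refine (coe_mem_flagContactFiltration_iff_deltaGE u hm ⟨hq, hqr₂, hr₂r₁⟩ (taylor φ h)).mp ?_
    rwa [natDegree_taylor]
  exact IsMinimal.mem_monomialIdeal_of_deltaGE_taylor H hu hrad hh hm1 hmin φ hα h1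

/-- Read-out of §3e in flag words: under its hypotheses the competing first member `X − C φ` lies in `F_{(X; C u₁)}(r₁)`.
[OURS · R10b §3e · PROVED] -/
theorem translate_first_member_mem_flagContactFiltration [IsNoetherianRing S₀] (u : Fin 2 → S₀)
    (hm : maximalIdeal S₀ = Ideal.span (Set.range u))
    (H : ∀ (i : Fin 2) (T : Finset (Fin 2)), i ∉ T →
      ∀ y, u i * y ∈ Ideal.span (u '' ↑T) → y ∈ Ideal.span (u '' ↑T))
    (hrad : (Ideal.span (Set.range u)).IsRadical)
    {h : S₀[X]} (hh : h.Monic) (hm1 : 1 ≤ h.natDegree) (hmin : IsMinimal u h)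
    {q r₁ r₂ : ℕ} (hadm : AdmissibleTriple q r₁ r₂) (φ : S₀)
    (hreach : ((taylor φ h : S₀[X]) : PowerSeries S₀) ∈
      flagContactFiltration (PowerSeries.X : PowerSeries S₀) (PowerSeries.C (u 1)) q r₁ r₂ (r₁ * h.natDegree)) :
    PowerSeries.X - PowerSeries.C φ ∈
      flagContactFiltration (PowerSeries.X : PowerSeries S₀) (PowerSeries.C (u 1)) q r₁ r₂ r₁ := by
  have hφ := mem_monomialIdeal_of_translate_reaches u hm H hrad hh hm1 hmin hadm φ hreach
  have hq : 0 < q := hadm.1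
  refine Ideal.sub_mem _ ?_ ?_
  · -- `X = X^1 · (C u₁)^0 · 1 ∈ span{X} · 𝔪^0`
    rw [flagContactFiltration_def]
    refine Submodule.mem_iSup_of_mem 1 (Submodule.mem_iSup_of_mem 0 ?_)
    have h0 : (r₁ - r₁ * 1 - r₂ * 0 + q - 1) / q = 0 := by
      rw [Nat.div_eq_zero_iff]; right; omega
    have hX : (PowerSeries.X : PowerSeries S₀) ∈
        Ideal.span {(PowerSeries.X : PowerSeries S₀) ^ 1 * PowerSeries.C (u 1) ^ 0} := by
      simp
    have h1 : (1 : PowerSeries S₀) ∈ maximalIdeal (PowerSeries S₀) ^ ((r₁ - r₁ * 1 - r₂ * 0 + q - 1) / q) := by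
      rw [h0, pow_zero, Ideal.one_eq_top]; exact Submodule.mem_top
    simpa using Ideal.mul_mem_mul hX h1
  · -- `C φ = C φ · X^0 ∈ F(r₁ · 1)` by §3c's generator lemma with `ν = 1`, `i = 0`
    have := C_mul_X_pow_mem_flagContactFiltration u hm hadm (ν := 1) (i := 0) (Nat.zero_le 1) (c := φ) (by simpa using hφ)
    simpa using this

end BridgeTranslate

/-! ### §3f Removing the automorphism: contraction along `S₀[X] → S₀⟦X⟧` and Taylor on `S₀[X]` -/

section Contraction

variable {S₀ : Type*} [CommRing S₀]

/-- Truncations of elements of `J · S₀⟦X⟧` lie in `J` as soon as `X^L ∈ J` (`N ≥ L`). [OURS · R10b §3f] -/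
theorem trunc_mem_of_mem_map_coe {J : Ideal S₀[X]} {L : ℕ} (hXL : (X : S₀[X]) ^ L ∈ J) {g : PowerSeries S₀}
    (hg : g ∈ J.map (Polynomial.coeToPowerSeries.ringHom : S₀[X] →+* PowerSeries S₀)) {N : ℕ} (hN : L ≤ N) :
    PowerSeries.trunc N g ∈ J := by
  -- the key step: for a POLYNOMIAL `m ∈ J`, `trunc N ↑m ∈ J`
  have key : ∀ m : S₀[X], m ∈ J → PowerSeries.trunc N (m : PowerSeries S₀) ∈ J := by
    intro m hm
    have hdvd : (X : S₀[X]) ^ N ∣ m - PowerSeries.trunc N (m : PowerSeries S₀) := by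
      rw [Polynomial.X_pow_dvd_iff]
      intro d hd
      rw [coeff_sub, PowerSeries.coeff_trunc, if_pos hd, Polynomial.coeff_coe, sub_self]
    obtain ⟨k, hk⟩ := hdvd
    have hXN : (X : S₀[X]) ^ N * k ∈ J := by
      rw [← Nat.sub_add_cancel hN, pow_add]
      exact J.mul_mem_right _ (J.mul_mem_left _ hXL)
    have : PowerSeries.trunc N (m : PowerSeries S₀) = m - X ^ N * k := by rw [← hk]; ring
    rw [this]
    exact J.sub_mem hm hXN
  rw [Ideal.map] at hg
  induction hg using Submodule.span_induction with
  | mem g hg' =>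
    obtain ⟨m, hm, rfl⟩ := hg'
    exact key m hm
  | zero => simp
  | add g g' _ _ hg hg' =>
    rw [map_add]
    exact J.add_mem hg hg'
  | smul s g _ hg =>
    rw [smul_eq_mul, ← PowerSeries.trunc_trunc_mul_trunc, ← Polynomial.coe_mul]
    exact key (PowerSeries.trunc N s * PowerSeries.trunc N g) (J.mul_mem_left _ hg)

/-- **CONTRACTION**: a polynomial lying in `J · S₀⟦X⟧` lies in `J`, provided `X^L ∈ J`. [OURS · R10b §3f] -/
theorem mem_of_coe_mem_map_coe {J : Ideal S₀[X]} {L : ℕ} (hXL : (X : S₀[X]) ^ L ∈ J) {k : S₀[X]}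
    (hk : (k : PowerSeries S₀) ∈ J.map (Polynomial.coeToPowerSeries.ringHom : S₀[X] →+* PowerSeries S₀)) : k ∈ J := by
  have h := trunc_mem_of_mem_map_coe hXL hk (N := max L (k.natDegree + 1)) (le_max_left _ _)
  rwa [PowerSeries.trunc_coe_eq_self (lt_of_lt_of_le (Nat.lt_succ_self _) (le_max_right _ _))] at h

end Contraction

section Frames

variable {S₀ : Type*} [CommRing S₀]

/-- The polynomial frame `(C u₀, C u₁, X − C φ)` of `S₀[X]`. -/
noncomputable def polyFrame (u : Fin 2 → S₀) (φ : S₀) : Fin 3 → S₀[X] :=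
  fun i => if i = 0 then C (u 0) else if i = 1 then C (u 1) else X - C φ

/-- `polyFrame u φ 0 = C u₀`. [OURS · R10b §3f · bookkeeping] -/
@[simp] theorem polyFrame_zero (u : Fin 2 → S₀) (φ : S₀) : polyFrame u φ 0 = C (u 0) := by simp [polyFrame]
/-- `polyFrame u φ 1 = C u₁`. [OURS · R10b §3f · bookkeeping] -/
@[simp] theorem polyFrame_one (u : Fin 2 → S₀) (φ : S₀) : polyFrame u φ 1 = C (u 1) := by simp [polyFrame]
/-- `polyFrame u φ 2 = X − C φ`. [OURS · R10b §3f · bookkeeping] -/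
@[simp] theorem polyFrame_two (u : Fin 2 → S₀) (φ : S₀) : polyFrame u φ 2 = X - C φ := by
  simp [polyFrame, show (2 : Fin 3) ≠ 0 from by decide, show (2 : Fin 3) ≠ 1 from by decide]

/-- The power-series frame `(C u₀, C u₁, X − C φ)` of `S₀⟦X⟧`. -/
noncomputable def psFrame (u : Fin 2 → S₀) (φ : S₀) : Fin 3 → PowerSeries S₀ :=
  fun i => if i = 0 then PowerSeries.C (u 0) else if i = 1 then PowerSeries.C (u 1) else PowerSeries.X - PowerSeries.C φ

/-- `psFrame u φ 0 = C u₀`. [OURS · R10b §3f · bookkeeping] -/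
@[simp] theorem psFrame_zero (u : Fin 2 → S₀) (φ : S₀) : psFrame u φ 0 = PowerSeries.C (u 0) := by simp [psFrame]
/-- `psFrame u φ 1 = C u₁`. [OURS · R10b §3f · bookkeeping] -/
@[simp] theorem psFrame_one (u : Fin 2 → S₀) (φ : S₀) : psFrame u φ 1 = PowerSeries.C (u 1) := by simp [psFrame]
/-- `psFrame u φ 2 = X − C φ`. [OURS · R10b §3f · bookkeeping] -/
@[simp] theorem psFrame_two (u : Fin 2 → S₀) (φ : S₀) : psFrame u φ 2 = PowerSeries.X - PowerSeries.C φ := by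
  simp [psFrame, show (2 : Fin 3) ≠ 0 from by decide, show (2 : Fin 3) ≠ 1 from by decide]

/-- The coercion `S₀[X] → S₀⟦X⟧` carries `polyFrame` to `psFrame`. [OURS · R10b §3f · bookkeeping] -/
theorem coe_comp_polyFrame (u : Fin 2 → S₀) (φ : S₀) :
    (Polynomial.coeToPowerSeries.ringHom : S₀[X] →+* PowerSeries S₀) ∘ polyFrame u φ = psFrame u φ := by
  funext i
  fin_cases i <;> simp [Polynomial.coeToPowerSeries.ringHom_apply, Polynomial.coe_C, Polynomial.coe_X]

/-- Taylor `X ↦ X + φ` carries the frame at `φ` to the frame at `0`. -/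
theorem taylor_comp_polyFrame (u : Fin 2 → S₀) (φ : S₀) :
    (taylorAlgHom φ : S₀[X] →+* S₀[X]) ∘ polyFrame u φ = polyFrame u 0 := by
  funext i
  fin_cases i
  · simp [taylor_C]
  · simp [taylor_C]
  · simp [taylor_X, taylor_C, map_sub]

variable [IsLocalRing S₀]

/-- `𝔪_{S₀⟦X⟧} = (C u₀, C u₁, X − C φ)` when `𝔪_{S₀} = (u₀, u₁)` and `φ ∈ 𝔪_{S₀}`. [OURS · R10b §3f] -/
theorem maximalIdeal_powerSeries_eq_span_psFrame (u : Fin 2 → S₀) (hm : maximalIdeal S₀ = Ideal.span (Set.range u))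
    {φ : S₀} (hφ : φ ∈ maximalIdeal S₀) :
    maximalIdeal (PowerSeries S₀) = Ideal.span (Set.range (psFrame u φ)) := by
  have hmem : ∀ {f : PowerSeries S₀}, f ∈ maximalIdeal (PowerSeries S₀) ↔ PowerSeries.constantCoeff f ∈ maximalIdeal S₀ := by
    intro f
    simp only [IsLocalRing.mem_maximalIdeal, mem_nonunits_iff, PowerSeries.isUnit_iff_constantCoeff]
  -- `C` of an element of `𝔪₀` lies in the span
  have hC : ∀ a ∈ maximalIdeal S₀, PowerSeries.C a ∈ Ideal.span (Set.range (psFrame u φ)) := by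
    intro a ha
    rw [hm] at ha
    have : PowerSeries.C a ∈ (Ideal.span (Set.range u)).map (PowerSeries.C : S₀ →+* PowerSeries S₀) :=
      Ideal.mem_map_of_mem _ ha
    rw [Ideal.map_span] at this
    refine Ideal.span_mono ?_ this
    rintro _ ⟨_, ⟨i, rfl⟩, rfl⟩
    fin_cases i
    · exact ⟨0, by simp⟩
    · exact ⟨1, by simp⟩
  have hX : (PowerSeries.X : PowerSeries S₀) ∈ Ideal.span (Set.range (psFrame u φ)) := by
    have : (PowerSeries.X : PowerSeries S₀) = (PowerSeries.X - PowerSeries.C φ) + PowerSeries.C φ := by ring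
    rw [this]
    exact Ideal.add_mem _ (Ideal.subset_span ⟨2, by simp⟩) (hC φ hφ)
  apply le_antisymm
  · intro f hf
    have hf0 := hmem.mp hf
    have hdec : f = PowerSeries.C (PowerSeries.constantCoeff f) +
        PowerSeries.X * PowerSeries.mk fun p => PowerSeries.coeff (p + 1) f := by
      rw [← PowerSeries.sub_const_eq_X_mul_shift]; ring
    rw [hdec]
    exact Ideal.add_mem _ (hC _ hf0) (Ideal.mul_mem_right _ _ hX)
  · rw [Ideal.span_le]
    rintro _ ⟨i, rfl⟩
    rw [SetLike.mem_coe, hmem]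
    fin_cases i
    · simpa using (show u 0 ∈ maximalIdeal S₀ by rw [hm]; exact Ideal.subset_span ⟨0, rfl⟩)
    · simpa using (show u 1 ∈ maximalIdeal S₀ by rw [hm]; exact Ideal.subset_span ⟨1, rfl⟩)
    · simpa using (maximalIdeal S₀).neg_mem hφ

omit [IsLocalRing S₀] in
/-- `X^n` lies in the polynomial monomial ideal of the frame at `φ ∈ (u₀, u₁)`, weights `(q, r₂, r₁)` with `1 ≤ q ≤ r₂, r₁`, level `n`.
[OURS · R10b §3f] -/
theorem X_pow_mem_monomialIdeal_polyFrame (u : Fin 2 → S₀) {φ : S₀} (hφ : φ ∈ Ideal.span (Set.range u))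
    {α : Fin 3 → ℝ} (hα : ∀ j, (1 : ℝ) ≤ α j) (n : ℕ) :
    (X : S₀[X]) ^ n ∈ monomialIdeal (polyFrame u φ) α n := by
  have hXs : (X : S₀[X]) ∈ Ideal.span (Set.range (polyFrame u φ)) := by
    have hCφ : C φ ∈ Ideal.span (Set.range (polyFrame u φ)) := by
      have : C φ ∈ (Ideal.span (Set.range u)).map (C : S₀ →+* S₀[X]) := Ideal.mem_map_of_mem _ hφ
      rw [Ideal.map_span] at this
      refine Ideal.span_mono ?_ this
      rintro _ ⟨_, ⟨i, rfl⟩, rfl⟩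
      fin_cases i
      · exact ⟨0, by simp⟩
      · exact ⟨1, by simp⟩
    have : (X : S₀[X]) = (X - C φ) + C φ := by ring
    rw [this]
    exact Ideal.add_mem _ (Ideal.subset_span ⟨2, by simp⟩) hCφ
  have h1 : (X : S₀[X]) ^ n ∈ Ideal.span (Set.range (polyFrame u φ)) ^ n := Ideal.pow_mem_pow hXs n
  have h2 := span_pow_le_monomialIdeal_one (polyFrame u φ) n h1
  refine Ideal.span_mono ?_ h2
  rintro m ⟨x, hx, rfl⟩
  refine ⟨x, hx.trans ?_, rfl⟩
  unfold weight
  exact Finset.sum_le_sum fun j _ => by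
    simpa using mul_le_mul_of_nonneg_right (hα j) (Nat.cast_nonneg (x j))

end Frames

section Translate

variable {S₀ : Type*} [CommRing S₀] [IsLocalRing S₀]

/-- **§3f THE `g₁`-CLAUSE FOR TRANSLATE FLAGS — NO AUTOMORPHISM, NO COMPLETENESS (R10b · OURS · PROVED)**.  `S₀` Noetherian local,
`𝔪_{S₀} = (u₀, u₁)` radical-generated with (H); `h ∈ S₀[X]` monic of degree `ν ≥ 1` with no solvable vertex (`IsMinimal u h`: the hub first
member is `X`); `0 < q ≤ r₂ ≤ r₁`; `φ ∈ 𝔪_{S₀}`.  IF THE TRANSLATE FLAG `(X − C φ; C u₁)` REACHES `h` in `S₀⟦X⟧` at level `r₁ ν`, THEN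
`φ ∈ I_α(u; 1)`, `α = (q/r₁, r₂/r₁)` — equivalently (`translate_first_member_mem`) `X − C φ ∈ F_{(X; C u₁)}(r₁)`: the hub flag DOMINATES every
reaching translate flag (the `g₂`-clause being trivial for a common second member).  Route: §3d (`F = monomialIdeal` for the frame
`(C u₀, C u₁, X − C φ)` of `S₀⟦X⟧`) → contraction to `S₀[X]` (`mem_of_coe_mem_map_coe`, using `Xⁿ ∈` the polynomial monomial ideal) → Taylor
`X ↦ X + φ` ON `S₀[X]` (`taylorAlgHom`, an honest automorphism of the polynomial ring) → extension to `S₀⟦X⟧` at the frame `(C u₀, C u₁, X)` → §3d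
→ §3c (`DeltaGE`) → §1 (Hironaka (4.8)).  Holds at EVERY admissible `(q; r₁, r₂)`, separable or not.  [OURS · R10b §3f · PROVED · not expert-reviewed] -/
theorem mem_monomialIdeal_of_translate_flag_reaches [IsNoetherianRing S₀] (u : Fin 2 → S₀)
    (hm : maximalIdeal S₀ = Ideal.span (Set.range u))
    (H : ∀ (i : Fin 2) (T : Finset (Fin 2)), i ∉ T →
      ∀ y, u i * y ∈ Ideal.span (u '' ↑T) → y ∈ Ideal.span (u '' ↑T))
    (hrad : (Ideal.span (Set.range u)).IsRadical)
    {h : S₀[X]} (hh : h.Monic) (hm1 : 1 ≤ h.natDegree) (hmin : IsMinimal u h)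
    {q r₁ r₂ : ℕ} (hadm : AdmissibleTriple q r₁ r₂) {φ : S₀} (hφ : φ ∈ maximalIdeal S₀)
    (hreach : (h : PowerSeries S₀) ∈
      flagContactFiltration (PowerSeries.X - PowerSeries.C φ : PowerSeries S₀) (PowerSeries.C (u 1)) q r₁ r₂ (r₁ * h.natDegree)) :
    φ ∈ monomialIdeal u (bridgeWeights q r₁ r₂) 1 := by
  obtain ⟨hq, hqr₂, hr₂r₁⟩ := hadm
  set n := r₁ * h.natDegree with hn
  have hq1 : ∀ j, (1 : ℝ) ≤ frameWeights q r₁ r₂ j := by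
    intro j
    fin_cases j
    · simpa using (show (1 : ℝ) ≤ q by exact_mod_cast hq)
    · simpa using (show (1 : ℝ) ≤ r₂ by exact_mod_cast (le_trans hq hqr₂))
    · simpa using (show (1 : ℝ) ≤ r₁ by exact_mod_cast (le_trans hq (hqr₂.trans hr₂r₁)))
  -- Step 1: `F_(X − Cφ; C u₁)(n)` is the monomial ideal of the power-series frame at `φ`
  have hmP := maximalIdeal_powerSeries_eq_span_psFrame u hm hφ
  have e1 := flagContactFiltration_eq_monomialIdeal (psFrame u φ) hmP ⟨hq, hqr₂, hr₂r₁⟩ n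
  rw [psFrame_two, psFrame_one] at e1
  rw [e1] at hreach
  -- Step 2: it is extended from `S₀[X]`; contract
  have e2 : monomialIdeal (psFrame u φ) (frameWeights q r₁ r₂) (n : ℝ) =
      (monomialIdeal (polyFrame u φ) (frameWeights q r₁ r₂) (n : ℝ)).map
        (Polynomial.coeToPowerSeries.ringHom : S₀[X] →+* PowerSeries S₀) := by
    rw [← monomialIdeal_comp_eq_map, coe_comp_polyFrame]
  rw [e2] at hreach
  have hφ' : φ ∈ Ideal.span (Set.range u) := hm ▸ hφ
  have hXn := X_pow_mem_monomialIdeal_polyFrame u hφ' hq1 n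
  have hh1 : h ∈ monomialIdeal (polyFrame u φ) (frameWeights q r₁ r₂) (n : ℝ) := mem_of_coe_mem_map_coe hXn hreach
  -- Step 3: Taylor on `S₀[X]`
  have hh2 : taylor φ h ∈ monomialIdeal (polyFrame u 0) (frameWeights q r₁ r₂) (n : ℝ) := by
    have := Ideal.mem_map_of_mem (taylorAlgHom φ : S₀[X] →+* S₀[X]) hh1
    rw [← monomialIdeal_comp_eq_map, taylor_comp_polyFrame] at this
    exact this
  -- Step 4: extend to `S₀⟦X⟧` at the frame `(C u₀, C u₁, X)`
  have hh3 : ((taylor φ h : S₀[X]) : PowerSeries S₀) ∈ monomialIdeal (psFrame u 0) (frameWeights q r₁ r₂) (n : ℝ) := by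
    rw [← coe_comp_polyFrame, monomialIdeal_comp_eq_map]
    simpa [Polynomial.coeToPowerSeries.ringHom_apply] using
      Ideal.mem_map_of_mem (Polynomial.coeToPowerSeries.ringHom : S₀[X] →+* PowerSeries S₀) hh2
  -- Step 5: which is `F_(X; C u₁)(n)`
  have hmP0 := maximalIdeal_powerSeries_eq_span_psFrame u hm (φ := 0) (Ideal.zero_mem _)
  have e0 := flagContactFiltration_eq_monomialIdeal (psFrame u 0) hmP0 ⟨hq, hqr₂, hr₂r₁⟩ n
  rw [psFrame_two, psFrame_one, map_zero, sub_zero] at e0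
  rw [← e0] at hh3
  -- Step 6: §3e = §3c + §1
  exact mem_monomialIdeal_of_translate_reaches u hm H hrad hh hm1 hmin ⟨hq, hqr₂, hr₂r₁⟩ φ hh3

/-- §3f in flag words: under its hypotheses, `X − C φ ∈ F_{(X; C u₁)}(r₁)` — the hub flag `(X; C u₁)` dominates the reaching translate flag
`(X − C φ; C u₁)` in the sense of SPEC (Δ12) rev 4 l.223 (first-member clause; the second members coincide). [OURS · R10b §3f · PROVED] -/
theorem translate_first_member_mem [IsNoetherianRing S₀] (u : Fin 2 → S₀)
    (hm : maximalIdeal S₀ = Ideal.span (Set.range u))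
    (H : ∀ (i : Fin 2) (T : Finset (Fin 2)), i ∉ T →
      ∀ y, u i * y ∈ Ideal.span (u '' ↑T) → y ∈ Ideal.span (u '' ↑T))
    (hrad : (Ideal.span (Set.range u)).IsRadical)
    {h : S₀[X]} (hh : h.Monic) (hm1 : 1 ≤ h.natDegree) (hmin : IsMinimal u h)
    {q r₁ r₂ : ℕ} (hadm : AdmissibleTriple q r₁ r₂) {φ : S₀} (hφ : φ ∈ maximalIdeal S₀)
    (hreach : (h : PowerSeries S₀) ∈
      flagContactFiltration (PowerSeries.X - PowerSeries.C φ : PowerSeries S₀) (PowerSeries.C (u 1)) q r₁ r₂ (r₁ * h.natDegree)) :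
    PowerSeries.X - PowerSeries.C φ ∈
      flagContactFiltration (PowerSeries.X : PowerSeries S₀) (PowerSeries.C (u 1)) q r₁ r₂ r₁ := by
  have hφ1 := mem_monomialIdeal_of_translate_flag_reaches u hm H hrad hh hm1 hmin hadm hφ hreach
  have hq : 0 < q := hadm.1
  refine Ideal.sub_mem _ ?_ ?_
  · rw [flagContactFiltration_def]
    refine Submodule.mem_iSup_of_mem 1 (Submodule.mem_iSup_of_mem 0 ?_)
    have h0 : (r₁ - r₁ * 1 - r₂ * 0 + q - 1) / q = 0 := by
      rw [Nat.div_eq_zero_iff]; right; omega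
    have hX : (PowerSeries.X : PowerSeries S₀) ∈
        Ideal.span {(PowerSeries.X : PowerSeries S₀) ^ 1 * PowerSeries.C (u 1) ^ 0} := by
      simp
    have h1 : (1 : PowerSeries S₀) ∈ maximalIdeal (PowerSeries S₀) ^ ((r₁ - r₁ * 1 - r₂ * 0 + q - 1) / q) := by
      rw [h0, pow_zero, Ideal.one_eq_top]; exact Submodule.mem_top
    simpa using Ideal.mul_mem_mul hX h1
  · have := C_mul_X_pow_mem_flagContactFiltration u hm hadm (ν := 1) (i := 0) (Nat.zero_le 1) (c := φ) (by simpa using hφ1)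
    simpa using this

end Translate
end Summit.ResolutionOfSingularities.ResolutionOfSingularities.Cruxes.HypersurfaceCentreConstruction.LocalEngine.Iota3
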